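import Literature.Analysis.Calculus.ResolutionChartSum
import HarnessLib

/-!
# Transport of resolution data along a real-analytic change of coordinates

The output of the simultaneous resolution of singularities of real-analytic functions
`F'₁, …, F'_l` on an open `O ⊆ ℝᵈ` (Watanabe 2009, Thm. 2.8; Lin 2017, Thm. 2.2 / Cor. 2.3;
Arnold–Gusein-Zade–Varchenko II, Part II §7.3, proof of Thm. 7.5) — a real-analytic `d`-manifold
`M`, a real-analytic map `g : M → O`, proper over `O`, bijective off the zero sets, and at every
point of the zero set a chart of the maximal analytic atlas in which each `F'ᵢ ∘ g` is
`(analytic unit) · monomial` and the Jacobian determinant of `g` is `(analytic unit) · monomial`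
(the hypothesis block `hchart` of the tree's `Resolution.exists_chartSum`) — is **transported along
a real-analytic diffeomorphism `Λ : O ≅ O'` onto functions `Fᵢ` with `Fᵢ ∘ Λ = F'ᵢ`**: the data
for the `Fᵢ` on `O'` are `(M, Λ ∘ g)` with the same charts and exponents, the Jacobian unit being
multiplied by the (analytic, nonvanishing) Jacobian determinant of `Λ` (`transport`). This is the
remark that the conclusion of Hironaka's theorem is invariant under analytic changes of
coordinates in the target (AGV II, Part II §7.3: the statement is about germs of analytic
functions "in suitable local coordinates"). Ingredients: the chain rule, multiplicativity of
`det`, and the analyticity of `f ↦ det f` on `L(ℝᵈ, ℝᵈ)` (Leibniz expansion,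
`analyticOnNhd_clm_det`).

Everything is proved; no definitions, no named facts.

## References

* V. I. Arnold, S. M. Gusein-Zade, A. N. Varchenko, *Singularities of Differentiable Maps* II
  (2012), Part II §7.3, proof of Thm. 7.5. [ArnoldGuseinzadeVarchenko2012]
* S. Watanabe, *Algebraic Geometry and Statistical Learning Theory* (2009), Thm. 2.8.
  [WatanabeSumio2009]
-/

noncomputable section

open Set Filter Function
open _root_.Topology
open scoped ContDiff Manifold

namespace Literature.Analysis.Calculus

namespace Resolution

variable {d : ℕ}

/-! ## The determinant is an analytic function of the linear map -/

/-- **`f ↦ det f` is real-analytic on `L(ℝᵈ, ℝᵈ)`** (it is a polynomial in the matrix entries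
`f(eⱼ)ᵢ`, which are continuous linear functionals of `f`). [folklore] -/
theorem analyticOnNhd_clm_det :
    AnalyticOnNhd ℝ (fun f : (Fin d → ℝ) →L[ℝ] (Fin d → ℝ) => f.det) univ := by
  classical
  have hentry : ∀ i j : Fin d, AnalyticOnNhd ℝ
      (fun f : (Fin d → ℝ) →L[ℝ] (Fin d → ℝ) =>
        LinearMap.toMatrix' (f : (Fin d → ℝ) →ₗ[ℝ] (Fin d → ℝ)) i j) univ := by
    intro i j f _
    have : (fun f : (Fin d → ℝ) →L[ℝ] (Fin d → ℝ) =>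
        LinearMap.toMatrix' (f : (Fin d → ℝ) →ₗ[ℝ] (Fin d → ℝ)) i j) =
        fun f => (ContinuousLinearMap.proj i : (Fin d → ℝ) →L[ℝ] ℝ)
          ((ContinuousLinearMap.apply ℝ (Fin d → ℝ) (Pi.single j 1)) f) := by
      funext f
      rw [LinearMap.toMatrix'_apply]
      rfl
    rw [this]
    exact ((ContinuousLinearMap.proj i : (Fin d → ℝ) →L[ℝ] ℝ).analyticAt _).comp
      ((ContinuousLinearMap.apply ℝ (Fin d → ℝ) (Pi.single j 1)).analyticAt f)
  have heq : (fun f : (Fin d → ℝ) →L[ℝ] (Fin d → ℝ) => f.det) =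
      fun f : (Fin d → ℝ) →L[ℝ] (Fin d → ℝ) =>
        ∑ σ : Equiv.Perm (Fin d), (Equiv.Perm.sign σ : ℝ) *
          ∏ i, LinearMap.toMatrix' (f : (Fin d → ℝ) →ₗ[ℝ] (Fin d → ℝ)) (σ i) i := by
    funext f
    rw [ContinuousLinearMap.det, ← LinearMap.det_toMatrix', Matrix.det_apply']
  rw [heq]
  refine Finset.analyticOnNhd_fun_sum _ fun σ _ => ?_
  exact analyticOnNhd_const.mul (Finset.analyticOnNhd_fun_prod _ fun i _ => hentry (σ i) i)

/-- The Jacobian determinant of a map with a differentiable local left inverse does not vanish.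
[folklore] -/
theorem det_fderiv_ne_zero_of_leftInverse {Λ Λ' : (Fin d → ℝ) → (Fin d → ℝ)} {v : Fin d → ℝ}
    (hΛ : DifferentiableAt ℝ Λ v) (hΛ' : DifferentiableAt ℝ Λ' (Λ v))
    (hinv : ∀ᶠ w in 𝓝 v, Λ' (Λ w) = w) : (fderiv ℝ Λ v).det ≠ 0 := by
  have hcomp : HasFDerivAt (Λ' ∘ Λ) ((fderiv ℝ Λ' (Λ v)).comp (fderiv ℝ Λ v)) v :=
    hΛ'.hasFDerivAt.comp v hΛ.hasFDerivAt
  have hid : HasFDerivAt (Λ' ∘ Λ) (ContinuousLinearMap.id ℝ (Fin d → ℝ)) v :=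
    (hasFDerivAt_id v).congr_of_eventuallyEq (hinv.mono fun w hw => hw)
  have heq := hcomp.unique hid
  have hdet := congrArg ContinuousLinearMap.det heq
  have hdetcomp : ∀ A B : (Fin d → ℝ) →L[ℝ] (Fin d → ℝ), (A.comp B).det = A.det * B.det :=
    fun A B => LinearMap.det_comp (A : (Fin d → ℝ) →ₗ[ℝ] (Fin d → ℝ)) (B : (Fin d → ℝ) →ₗ[ℝ] _)
  rw [hdetcomp] at hdet
  have hid' : (ContinuousLinearMap.id ℝ (Fin d → ℝ)).det = 1 := by
    change LinearMap.det (LinearMap.id : (Fin d → ℝ) →ₗ[ℝ] (Fin d → ℝ)) = 1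
    exact LinearMap.det_id
  rw [hid'] at hdet
  intro h0
  rw [h0, mul_zero] at hdet
  exact zero_ne_one hdet

/-! ## Transport of resolution data -/

/-- **Transport of resolution data along an analytic diffeomorphism of the base.** Let
`Λ : O ≅ O'` be a homeomorphism between open subsets of `ℝᵈ`, analytic together with its inverse,
and `Fᵢ ∘ Λ = F'ᵢ` on `O`. If `(M, g)` are resolution data for the `F'ᵢ` over `O` (analytic `g`
with values in `O`, proper over `O`, bijective from `{F' ∘ g ≠ 0}` onto `{v ∈ O | F' v ≠ 0}`,
monomial charts at the points of the zero set), then `(M, Λ ∘ g)` are resolution data for the `Fᵢ`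
over `O'`, with the same charts, exponents and units `aᵢ`, and Jacobian unit
`det DΛ(g(φ⁻¹u)) · b(u)`. [cite: ArnoldGuseinzadeVarchenko2012, Part II §7.3, proof of Thm. 7.5]
[cite: WatanabeSumio2009, Thm. 2.8] -/
theorem transport {l : ℕ} {F F' : Fin l → (Fin d → ℝ) → ℝ}
    (Λ : OpenPartialHomeomorph (Fin d → ℝ) (Fin d → ℝ))
    (hΛ : AnalyticOnNhd ℝ Λ Λ.source) (hΛs : AnalyticOnNhd ℝ Λ.symm Λ.target)
    (hFF' : ∀ i, ∀ v ∈ Λ.source, F i (Λ v) = F' i v)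
    {M : Type*} [TopologicalSpace M] [ChartedSpace (Fin d → ℝ) M]
    [IsManifold 𝓘(ℝ, Fin d → ℝ) ω M] {g : M → (Fin d → ℝ)}
    (hgO : ∀ p, g p ∈ Λ.source)
    (hg : ContMDiff 𝓘(ℝ, Fin d → ℝ) 𝓘(ℝ, Fin d → ℝ) ω g)
    (hprop : ∀ K ⊆ Λ.source, IsCompact K → IsCompact (g ⁻¹' K))
    (hbij : BijOn g {p | ∀ i, F' i (g p) ≠ 0} {x ∈ Λ.source | ∀ i, F' i x ≠ 0})
    (hchart : ∀ p : M, (∃ i, F' i (g p) = 0) →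
      ∃ φ : OpenPartialHomeomorph M (Fin d → ℝ),
        φ ∈ IsManifold.maximalAtlas 𝓘(ℝ, Fin d → ℝ) ω M ∧ p ∈ φ.source ∧ φ p = 0 ∧
        ∃ (k : Fin l → Fin d → ℕ) (h : Fin d → ℕ) (a : Fin l → (Fin d → ℝ) → ℝ)
          (b : (Fin d → ℝ) → ℝ),
          (∀ i, AnalyticOnNhd ℝ (a i) φ.target) ∧ AnalyticOnNhd ℝ b φ.target ∧
          (∀ i, ∀ u ∈ φ.target, a i u ≠ 0) ∧ (∀ u ∈ φ.target, b u ≠ 0) ∧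
          (∀ i, ∀ u ∈ φ.target, F' i (g (φ.symm u)) = a i u * ∏ j, u j ^ k i j) ∧
          (∀ u ∈ φ.target, (fderiv ℝ (g ∘ φ.symm) u).det = b u * ∏ j, u j ^ h j)) :
    (∀ p, (Λ ∘ g) p ∈ Λ.target) ∧
    ContMDiff 𝓘(ℝ, Fin d → ℝ) 𝓘(ℝ, Fin d → ℝ) ω (Λ ∘ g) ∧
    (∀ K ⊆ Λ.target, IsCompact K → IsCompact ((Λ ∘ g) ⁻¹' K)) ∧
    BijOn (Λ ∘ g) {p | ∀ i, F i ((Λ ∘ g) p) ≠ 0} {x ∈ Λ.target | ∀ i, F i x ≠ 0} ∧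
    ∀ p : M, (∃ i, F i ((Λ ∘ g) p) = 0) →
      ∃ φ : OpenPartialHomeomorph M (Fin d → ℝ),
        φ ∈ IsManifold.maximalAtlas 𝓘(ℝ, Fin d → ℝ) ω M ∧ p ∈ φ.source ∧ φ p = 0 ∧
        ∃ (k : Fin l → Fin d → ℕ) (h : Fin d → ℕ) (a : Fin l → (Fin d → ℝ) → ℝ)
          (b : (Fin d → ℝ) → ℝ),
          (∀ i, AnalyticOnNhd ℝ (a i) φ.target) ∧ AnalyticOnNhd ℝ b φ.target ∧
          (∀ i, ∀ u ∈ φ.target, a i u ≠ 0) ∧ (∀ u ∈ φ.target, b u ≠ 0) ∧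
          (∀ i, ∀ u ∈ φ.target, F i ((Λ ∘ g) (φ.symm u)) = a i u * ∏ j, u j ^ k i j) ∧
          (∀ u ∈ φ.target, (fderiv ℝ ((Λ ∘ g) ∘ φ.symm) u).det = b u * ∏ j, u j ^ h j) := by
  have hgO' : ∀ p, (Λ ∘ g) p ∈ Λ.target := fun p => Λ.map_source (hgO p)
  -- values of the `F'ᵢ ∘ g` are values of the `Fᵢ ∘ Λ ∘ g`
  have hval : ∀ i p, F i ((Λ ∘ g) p) = F' i (g p) := fun i p => hFF' i (g p) (hgO p)
  -- the Jacobian determinant of `Λ` is an analytic unit on `Λ.source`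
  have hdetan : AnalyticOnNhd ℝ (fun v => (fderiv ℝ Λ v).det) Λ.source :=
    analyticOnNhd_clm_det.comp (hΛ.fderiv_of_isOpen Λ.open_source) (mapsTo_univ _ _)
  have hdet0 : ∀ v ∈ Λ.source, (fderiv ℝ Λ v).det ≠ 0 := by
    intro v hv
    refine det_fderiv_ne_zero_of_leftInverse (Λ' := Λ.symm) (hΛ v hv).differentiableAt
      (hΛs _ (Λ.map_source hv)).differentiableAt ?_
    exact Λ.eventually_left_inverse hv
  refine ⟨hgO', ?_, ?_, ?_, ?_⟩
  · -- analyticity of `Λ ∘ g`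
    have h1 : ContMDiffOn 𝓘(ℝ, Fin d → ℝ) 𝓘(ℝ, Fin d → ℝ) ω Λ Λ.source :=
      contMDiffOn_iff_contDiffOn.2 (hΛ.contDiffOn_of_completeSpace.of_le le_top)
    exact h1.comp_contMDiff hg hgO
  · -- properness over `Λ.target`
    intro K hK hKc
    have hK' : IsCompact (Λ.symm '' K) :=
      hKc.image_of_continuousOn (Λ.continuousOn_symm.mono hK)
    have hK'sub : Λ.symm '' K ⊆ Λ.source := by
      rintro _ ⟨x, hx, rfl⟩; exact Λ.map_target (hK hx)
    have hEq : (Λ ∘ g) ⁻¹' K = g ⁻¹' (Λ.symm '' K) := by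
      ext p
      simp only [mem_preimage, Function.comp_apply, mem_image]
      constructor
      · intro hp
        exact ⟨Λ (g p), hp, Λ.left_inv (hgO p)⟩
      · rintro ⟨x, hx, hxp⟩
        have : Λ (g p) = x := by rw [← hxp, Λ.right_inv (hK hx)]
        rw [this]; exact hx
    rw [hEq]
    exact hprop _ hK'sub hK'
  · -- bijectivity off the zero sets
    refine ⟨fun p hp => ⟨hgO' p, hp⟩, ?_, ?_⟩
    · intro p hp p' hp' hpp'
      have h1 : g p = g p' := Λ.injOn (hgO p) (hgO p') hpp'
      have hpF : p ∈ {p | ∀ i, F' i (g p) ≠ 0} := fun i => by rw [← hval i p]; exact hp i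
      have hp'F : p' ∈ {p | ∀ i, F' i (g p) ≠ 0} := fun i => by rw [← hval i p']; exact hp' i
      exact hbij.injOn hpF hp'F h1
    · intro x hx
      obtain ⟨hxT, hxF⟩ := hx
      have hv : Λ.symm x ∈ {x ∈ Λ.source | ∀ i, F' i x ≠ 0} := by
        refine ⟨Λ.map_target hxT, fun i => ?_⟩
        rw [← hFF' i _ (Λ.map_target hxT), Λ.right_inv hxT]
        exact hxF i
      obtain ⟨p, hp, hpx⟩ := hbij.surjOn hv
      refine ⟨p, fun i => ?_, ?_⟩
      · show F i (Λ (g p)) ≠ 0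
        rw [hpx, Λ.right_inv hxT]; exact hxF i
      · show Λ (g p) = x
        rw [hpx, Λ.right_inv hxT]
  · -- the monomial charts
    intro p hp
    obtain ⟨i₀, hi₀⟩ := hp
    rw [hval] at hi₀
    obtain ⟨φ, hφ, hpφ, hφ0, k, h, a, b, ha, hb, ha0, hb0, hFa, hJb⟩ := hchart p ⟨i₀, hi₀⟩
    have hgan : AnalyticOnNhd ℝ (g ∘ φ.symm) φ.target := analyticOnNhd_comp_symm hg hφ
    have hmaps : MapsTo (g ∘ φ.symm) φ.target Λ.source := fun u _ => hgO _
    refine ⟨φ, hφ, hpφ, hφ0, k, h, a, fun u => (fderiv ℝ Λ (g (φ.symm u))).det * b u,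
      ha, ?_, ha0, ?_, ?_, ?_⟩
    · exact (hdetan.comp hgan hmaps).mul hb
    · intro u hu
      exact mul_ne_zero (hdet0 _ (hgO _)) (hb0 u hu)
    · intro i u hu
      rw [hval]
      exact hFa i u hu
    · intro u hu
      have hd1 : DifferentiableAt ℝ Λ ((g ∘ φ.symm) u) := (hΛ _ (hgO _)).differentiableAt
      have hd2 : DifferentiableAt ℝ (g ∘ φ.symm) u := (hgan u hu).differentiableAt
      have hdetcomp : ∀ A B : (Fin d → ℝ) →L[ℝ] (Fin d → ℝ), (A.comp B).det = A.det * B.det :=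
        fun A B => LinearMap.det_comp (A : (Fin d → ℝ) →ₗ[ℝ] (Fin d → ℝ)) (B : (Fin d → ℝ) →ₗ[ℝ] _)
      rw [show (Λ ∘ g) ∘ φ.symm = Λ ∘ (g ∘ φ.symm) from rfl, fderiv_comp u hd1 hd2,
        hdetcomp]
      change (fderiv ℝ Λ (g (φ.symm u))).det * (fderiv ℝ (g ∘ φ.symm) u).det =
        (fderiv ℝ Λ (g (φ.symm u))).det * b u * ∏ j, u j ^ h j
      rw [hJb u hu]
      ring

end Resolution

end Literature.Analysis.Calculus

end
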